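import Mathlib
import Literature.NumberTheory.LFunctions.WeilExplicit
import Literature.NumberTheory.LFunctions.WeilExplicitProofs
import Literature.NumberTheory.LFunctions.WeilMellinInversion

/-!
# Motivic door (pub-rhdoor, lad-3): parity bookkeeping for the vanishing conditions of the
Weil / Connes–Consani positivity classes

Context (LADDER-lad3 §B8 addendum, census T1S-6). Connes–Consani 2021 (arXiv:2006.13771, Thm 1)
prove `W_∞(g ∗ g*) ≥ Tr(ϑ(g) S ϑ(g)*)` for `g` supported in `[2^{-1/2}, 2^{1/2}]` whose Mellin
transform vanishes at ONE polar point and at the CENTRE. In the tree's additive normalisation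
`ĝ(s) = ∫ g(t) e^{(s-1/2)t} dt` (`weilMellin`) the polar points are `s = 0, 1` and the centre is
`s = 1/2`. The elementary facts below are what makes the comparison of classes precise:

* for EVEN `g`: `ĝ(s) = ĝ(1-s)`, so `ĝ(0) = ĝ(1)` — one polar condition is the same as two;
* for ODD `g`: `ĝ(s) = -ĝ(1-s)`, so `ĝ(0) = -ĝ(1)` and `ĝ(1/2) = 0` — the centre condition is
  automatic;
* for every continuous compactly supported `g`, the polar term of `f = g ⋆ g̃` is
  `f̂(0) + f̂(1) = 2 Re(ĝ(0) conj ĝ(1))`, hence it vanishes as soon as ONE of `ĝ(0)`, `ĝ(1)` does.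

Consequently per-parity-sector computations cannot distinguish the one-pole, two-pole and
Connes–Consani classes; they differ only through mixed-parity `g` (DATA on the crossovers of the
semi-local forms on these classes: pub-rhdoor census T1S-6). Note that the tree's
`WeilPositivityOn a` / `WeilSemilocalPositivityOn S a` carry NO vanishing condition at all.

All statements here are elementary [PROVED]; nothing is claimed about RH.
-/

namespace Summit.RiemannHypothesis.RiemannHypothesis.Theorems.MotivicDoor.ParityClasses

open Literature.NumberTheory.LFunctions Complex MeasureTheory
open scoped ComplexConjugate

variable {g : ℝ → ℂ}

/-- `(-g)^(s) = -ĝ(s)`. -/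
theorem weilMellin_neg_fun (g : ℝ → ℂ) (s : ℂ) :
    weilMellin (fun t ↦ -g t) s = -weilMellin g s := by
  unfold weilMellin
  rw [← integral_neg]
  congr 1 with t
  ring

/-- Even test functions: `ĝ(s) = ĝ(1 - s)`. -/
theorem weilMellin_eq_one_sub_of_even (h : ∀ t, g (-t) = g t) (s : ℂ) :
    weilMellin g s = weilMellin g (1 - s) := by
  have h1 := weilMellin_comp_neg g s
  have hfun : (fun t ↦ g (-t)) = g := funext h
  rwa [hfun] at h1

/-- Odd test functions: `ĝ(s) = -ĝ(1 - s)`. -/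
theorem weilMellin_eq_neg_one_sub_of_odd (h : ∀ t, g (-t) = -g t) (s : ℂ) :
    weilMellin g s = -weilMellin g (1 - s) := by
  have h1 := weilMellin_comp_neg g s
  have hfun : (fun t ↦ g (-t)) = fun t ↦ -g t := funext h
  rw [hfun, weilMellin_neg_fun] at h1
  linear_combination -h1

/-- Even: the two polar values coincide, `ĝ(0) = ĝ(1)`. -/
theorem weilMellin_zero_eq_one_of_even (h : ∀ t, g (-t) = g t) :
    weilMellin g 0 = weilMellin g 1 := by
  simpa using weilMellin_eq_one_sub_of_even h 0

/-- Odd: the two polar values are opposite, `ĝ(0) = -ĝ(1)`. -/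
theorem weilMellin_zero_eq_neg_one_of_odd (h : ∀ t, g (-t) = -g t) :
    weilMellin g 0 = -weilMellin g 1 := by
  simpa using weilMellin_eq_neg_one_sub_of_odd h 0

/-- Odd: the centre value vanishes, `ĝ(1/2) = 0` (the Connes–Consani centre condition is
automatic in the odd sector). -/
theorem weilMellin_half_eq_zero_of_odd (h : ∀ t, g (-t) = -g t) :
    weilMellin g (1 / 2) = 0 := by
  have h1 := weilMellin_eq_neg_one_sub_of_odd h (1 / 2)
  have h2 : (1 : ℂ) - 1 / 2 = 1 / 2 := by norm_num
  rw [h2] at h1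
  linear_combination h1 / 2

/-- Even sector: one polar condition is equivalent to the other. -/
theorem weilMellin_zero_eq_zero_iff_of_even (h : ∀ t, g (-t) = g t) :
    weilMellin g 0 = 0 ↔ weilMellin g 1 = 0 := by
  rw [weilMellin_zero_eq_one_of_even h]

/-- Odd sector: one polar condition is equivalent to the other. -/
theorem weilMellin_zero_eq_zero_iff_of_odd (h : ∀ t, g (-t) = -g t) :
    weilMellin g 0 = 0 ↔ weilMellin g 1 = 0 := by
  rw [weilMellin_zero_eq_neg_one_of_odd h, neg_eq_zero]

/-- The polar term of `f = g ⋆ g̃` is `f̂(0) + f̂(1) = ĝ(0) conj ĝ(1) + conj(ĝ(0) conj ĝ(1))`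
(`= 2 Re(ĝ(0) conj ĝ(1))`), for continuous compactly supported `g`. -/
theorem weilPolarTerm_weilConv_weilReflect (hg : Continuous g) (hg' : HasCompactSupport g) :
    weilPolarTerm (weilConv g (weilReflect g)) =
      weilMellin g 0 * conj (weilMellin g 1) + conj (weilMellin g 0 * conj (weilMellin g 1)) := by
  have hr : Continuous (weilReflect g) :=
    Complex.continuous_conj.comp (hg.comp continuous_neg)
  have hr' : HasCompactSupport (weilReflect g) := by
    have h1 : HasCompactSupport (fun t ↦ g (-t)) := hg'.comp_homeomorph (Homeomorph.neg ℝ)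
    exact h1.comp_left (g := fun z : ℂ ↦ conj z) (map_zero _)
  have hm := fun s ↦ weilMellin_weilConv_holds hg hg' hr hr' s
  have hrefl := weilMellin_weilReflect_holds g
  unfold weilPolarTerm
  rw [hm 0, hm 1, hrefl 0, hrefl 1]
  simp [map_mul]
  ring

/-- The polar term of `g ⋆ g̃` is the real number `2 Re(ĝ(0) conj ĝ(1))`. -/
theorem weilPolarTerm_weilConv_weilReflect_eq_re (hg : Continuous g) (hg' : HasCompactSupport g) :
    weilPolarTerm (weilConv g (weilReflect g)) =
      ((2 * (weilMellin g 0 * conj (weilMellin g 1)).re : ℝ) : ℂ) := by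
  rw [weilPolarTerm_weilConv_weilReflect hg hg', Complex.add_conj]

/-- ONE polar condition on `g` kills the polar term of `g ⋆ g̃`. -/
theorem weilPolarTerm_weilConv_weilReflect_eq_zero (hg : Continuous g) (hg' : HasCompactSupport g)
    (h : weilMellin g 0 = 0 ∨ weilMellin g 1 = 0) :
    weilPolarTerm (weilConv g (weilReflect g)) = 0 := by
  rw [weilPolarTerm_weilConv_weilReflect hg hg']
  rcases h with h0 | h1
  · simp [h0]
  · simp [h1]

end Summit.RiemannHypothesis.RiemannHypothesis.Theorems.MotivicDoor.ParityClasses
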